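import Literature.Geometry.Lorentzian.FinalState
import Literature.Geometry.Lorentzian.TameGenericity
import Literature.Geometry.Lorentzian.TameGenericityLocal
import Literature.Geometry.Lorentzian.TameGenericityDiagonal
import Literature.Geometry.Lorentzian.AsymptoticFlatness
import HarnessLib

/-!
# Helpers for stub `stub_farCleaning` of line `Sketch` of crux `HonestFixedRadiusSettlingT`
# (stmt-FinalStateConjecture-17575): the free cases of kick-free far-field cleaning

The registered stub `stub_farCleaning` (reshape c2 of the line) asks, through EVERY admissible
datum `d ∈ admissibleVacuumData X`, for a TAME curve `G` of ADMISSIBLE data on one end `e`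
(`InitialDataSet.IsTameDataFamily e 1 G`: jointly smooth, `e` sole, every member
Dafermos–Rodnianski flat on `e` with a continuous mass, `e.wDist (G c) (G 0) → 0`), `G 0 = d`,
whose members off `0` are far-clean to order `(6, 5)` on `e`
(`e.IsStronglyAsymptoticallyFlatWith (G c) M 1 2 6 5`). No immersion and no injectivity are asked
(that is the difference with the cycle-1 stub `stub_broom`, served by
`Theorems/StarvedNecksHonestFixedRadiusSettlingTStubBroomHelpers.lean`). The general case is
charge-matched far-field gluing onto a clean (e.g. Kerr) end beyond a receding radius, with SMOOTH
dependence on the gluing radius (joint smoothness of the curve) and UNIFORM weighted tail estimates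
(`wDist → 0`): Corvino–Schoen 2006, Thm. 1; Chruściel–Delay 2003, §7; Mao–Oh–Tao 2023, Thm. 1.7 —
the tree has only the existence-per-annulus form `MaoOhTao.ObstructionFreeAnnularGluing` (named
fact, no parameter dependence) and the compactly supported `ChruscielDelay_localConstraintDeformation`,
neither of which yields a jointly smooth curve. This support file records the bookkeeping that IS
free over the tree:

* `farCleaning_of_farClean` — an admissible datum far-clean to order `(6, 5)` on a sole end is the
  base of the CONSTANT tame curve, which witnesses the stub's conclusion at it;
* `farCleaning_of_local` — arc-locality of the stub's conclusion (far-clean members for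
  `0 < ‖c‖ < ε` suffice), by the kick-free form of `InitialDataSet.exists_tameFamily_of_local`
  (radial reparametrisation; no immersion / injectivity to transport);
* `farCleaning_of_broom`, `farCleaning_of_forall_broom` — the cycle-1 conclusion shape (with
  immersion and injectivity) implies the kick-free one, pointwise and globally, so every landed
  broom helper (`Theorems.StarvedNecks.Broom.broom_of_farClean`, `broom_of_local`) transfers;
* `farCleaning_of_onEnd` — it suffices to answer given the sole Dafermos–Rodnianski end handed over
  by admissibility (`exists_isSoleEnd_of_mem_admissibleVacuumData`).

No definitions, no named facts, no `sorry`.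
-/

set_option linter.dupNamespace false

noncomputable section

open scoped Manifold ContDiff Topology
open Filter Set Function Literature.Geometry.Lorentzian

namespace Summit.FinalStateConjecture.FinalStateConjecture.Theorems.StarvedNecks.FarCleaning

/-- **Kick-free arc-locality of tame families.** A tame `m`-parameter family `F` of `𝓓`-data on
the end `e` whose members with `0 < ‖c‖ < ε` satisfy `P` yields a tame family `F'` of `𝓓`-data on
the same end with `F' 0 = F 0` all of whose members off `0` satisfy `P`: reparametrise by the radial
contraction of the parameter space into the `ε`-ball (`exists_contDiff_radialContraction`; tameness
composes by `InitialDataSet.IsTameDataFamily.comp_contDiff`). This is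
`InitialDataSet.exists_tameFamily_of_local` without the immersion and injectivity clauses.
[folklore] -/
private theorem exists_tameFamily_of_local_kickFree {X : Type} [TopologicalSpace X]
    [ChartedSpace E3 X] [IsManifold (𝓡 3) ∞ X] {e : AFEnd X} {m : ℕ}
    {𝓓 : Set (InitialDataSet (𝓡 3) X)} {P : InitialDataSet (𝓡 3) X → Prop}
    {F : EuclideanSpace ℝ (Fin m) → InitialDataSet (𝓡 3) X}
    (hF : InitialDataSet.IsTameDataFamily e m F) (h𝓓 : ∀ c, F c ∈ 𝓓) {ε : ℝ} (hε : 0 < ε)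
    (hP : ∀ c, c ≠ 0 → ‖c‖ < ε → P (F c)) :
    ∃ F' : EuclideanSpace ℝ (Fin m) → InitialDataSet (𝓡 3) X,
      InitialDataSet.IsTameDataFamily e m F' ∧ F' 0 = F 0 ∧ (∀ c, F' c ∈ 𝓓) ∧
        ∀ c ≠ 0, P (F' c) := by
  obtain ⟨φ, hφ, -, hφ0, hball, hφne, -⟩ :=
    exists_contDiff_radialContraction (V := EuclideanSpace ℝ (Fin m)) hε
  exact ⟨fun c ↦ F (φ c), hF.comp_contDiff hφ hφ0, by simp [hφ0], fun c ↦ h𝓓 _,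
    fun c hc ↦ hP (φ c) (fun h ↦ hc (hφne c h)) (hball c)⟩

/-- **Far-clean admissible data are the base of a far-cleaning curve (the constant one).** If
`d ∈ admissibleVacuumData X` is far-clean to order `(6, 5)` with mass `M` on a sole end `e`
(`e.IsStronglyAsymptoticallyFlatWith d M 1 2 6 5`), then the conclusion of `stub_farCleaning` holds
at `d` (witness end `e` itself): the constant curve `fun _ ↦ d` is tame
(`InitialDataSet.isTameDataFamily_const`, fed with the Dafermos–Rodnianski decay obtained by
dropping derivative counts, `IsStronglyAsymptoticallyFlatWith.mono_count`), its members are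
admissible and far-clean with mass `M`. [cite: Christodoulou1999, p. A24] -/
theorem farCleaning_of_farClean : ∀ {X : Type} [TopologicalSpace X] [ChartedSpace E3 X] [IsManifold (𝓡 3) ∞ X] {d : InitialDataSet (𝓡 3) X}, d ∈ admissibleVacuumData X → ∀ {e : AFEnd X}, e.IsSoleEnd → ∀ {M : ℝ}, e.IsStronglyAsymptoticallyFlatWith d M 1 2 6 5 → ∃ (e' : AFEnd X) (G : EuclideanSpace ℝ (Fin 1) → InitialDataSet (𝓡 3) X), InitialDataSet.IsTameDataFamily e' 1 G ∧ G 0 = d ∧ (∀ c, G c ∈ admissibleVacuumData X) ∧ ∀ c ≠ 0, ∃ M : ℝ, e'.IsStronglyAsymptoticallyFlatWith (G c) M 1 2 6 5 := by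
  intro X _ _ _ d hd e he M hclean
  exact ⟨e, fun _ ↦ d,
    InitialDataSet.isTameDataFamily_const he 1 (hclean.mono_count (by norm_num) (by norm_num)), rfl,
    fun _ ↦ hd, fun _ _ ↦ ⟨M, hclean⟩⟩

/-- **Arc-locality of far-field cleaning.** A tame curve of admissible data through `d` on the end
`e` whose members with `0 < ‖c‖ < ε` are far-clean to order `(6, 5)` on `e` yields one (same end,
same base datum) all of whose members off `0` are far-clean: reparametrise by the radial contraction
of the parameter line into the `ε`-interval (`exists_contDiff_radialContraction`,
`InitialDataSet.IsTameDataFamily.comp_contDiff`). So any construction of far-cleaning curves need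
only control small parameters (large gluing radii). [cite: Christodoulou1999, p. A24] -/
theorem farCleaning_of_local : ∀ {X : Type} [TopologicalSpace X] [ChartedSpace E3 X] [IsManifold (𝓡 3) ∞ X] {d : InitialDataSet (𝓡 3) X} {e : AFEnd X} {G : EuclideanSpace ℝ (Fin 1) → InitialDataSet (𝓡 3) X}, InitialDataSet.IsTameDataFamily e 1 G → G 0 = d → (∀ c, G c ∈ admissibleVacuumData X) → ∀ {ε : ℝ}, 0 < ε → (∀ c, c ≠ 0 → ‖c‖ < ε → ∃ M : ℝ, e.IsStronglyAsymptoticallyFlatWith (G c) M 1 2 6 5) → ∃ (e' : AFEnd X) (G' : EuclideanSpace ℝ (Fin 1) → InitialDataSet (𝓡 3) X), InitialDataSet.IsTameDataFamily e' 1 G' ∧ G' 0 = d ∧ (∀ c, G' c ∈ admissibleVacuumData X) ∧ ∀ c ≠ 0, ∃ M : ℝ, e'.IsStronglyAsymptoticallyFlatWith (G' c) M 1 2 6 5 := by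
  intro X _ _ _ d e G hG h0 h𝓓 ε hε hclean
  obtain ⟨G', hG', hG'0, h𝓓', hP'⟩ :=
    exists_tameFamily_of_local_kickFree
      (P := fun D ↦ ∃ M : ℝ, e.IsStronglyAsymptoticallyFlatWith D M 1 2 6 5) hG h𝓓 hε hclean
  exact ⟨e, G', hG', hG'0.trans h0, h𝓓', hP'⟩

/-- **A broom is a far-cleaning curve.** The cycle-1 conclusion shape at `d` (a tame, IMMERSED,
INJECTIVE curve of admissible data through `d` whose members off `0` are far-clean to order `(6, 5)`,
e.g. the conclusion of `Theorems.StarvedNecks.Broom.broom_of_farClean` / `broom_of_local`) implies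
the kick-free conclusion of `stub_farCleaning` at `d` (drop the two conjuncts). [folklore] -/
theorem farCleaning_of_broom : ∀ {X : Type} [TopologicalSpace X] [ChartedSpace E3 X] [IsManifold (𝓡 3) ∞ X] {d : InitialDataSet (𝓡 3) X}, (∃ (e : AFEnd X) (F : EuclideanSpace ℝ (Fin 1) → InitialDataSet (𝓡 3) X), InitialDataSet.IsTameDataFamily e 1 F ∧ InitialDataSet.IsImmersedAtZero 1 F ∧ F 0 = d ∧ Function.Injective F ∧ (∀ c, F c ∈ admissibleVacuumData X) ∧ ∀ c ≠ 0, ∃ M : ℝ, e.IsStronglyAsymptoticallyFlatWith (F c) M 1 2 6 5) → ∃ (e : AFEnd X) (G : EuclideanSpace ℝ (Fin 1) → InitialDataSet (𝓡 3) X), InitialDataSet.IsTameDataFamily e 1 G ∧ G 0 = d ∧ (∀ c, G c ∈ admissibleVacuumData X) ∧ ∀ c ≠ 0, ∃ M : ℝ, e.IsStronglyAsymptoticallyFlatWith (G c) M 1 2 6 5 := by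
  intro X _ _ _ d h
  obtain ⟨e, F, hF, -, h0, -, h𝓓, hclean⟩ := h
  exact ⟨e, F, hF, h0, h𝓓, hclean⟩

/-- **The cycle-1 elliptic stub implies the cycle-2 one, globally**: if through every admissible
datum of every admissible `3`-manifold passes a broom (tame, immersed, injective admissible curve with
far-clean members off `0` — the cycle-1 registered stub `stub_broom`), then through every admissible
datum passes a far-cleaning curve (the conclusion is the text of the cycle-2 stub `stub_farCleaning`).
[folklore] -/
theorem farCleaning_of_forall_broom : (∀ (X : Type) [TopologicalSpace X] [ChartedSpace E3 X] [IsManifold (𝓡 3) ∞ X] [T2Space X] [SecondCountableTopology X] [ConnectedSpace X], ∀ d ∈ admissibleVacuumData X, ∃ (e : AFEnd X) (F : EuclideanSpace ℝ (Fin 1) → InitialDataSet (𝓡 3) X), InitialDataSet.IsTameDataFamily e 1 F ∧ InitialDataSet.IsImmersedAtZero 1 F ∧ F 0 = d ∧ Function.Injective F ∧ (∀ c, F c ∈ admissibleVacuumData X) ∧ ∀ c ≠ 0, ∃ M : ℝ, e.IsStronglyAsymptoticallyFlatWith (F c) M 1 2 6 5) → ∀ (X : Type) [TopologicalSpace X]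 [ChartedSpace E3 X] [IsManifold (𝓡 3) ∞ X] [T2Space X] [SecondCountableTopology X] [ConnectedSpace X], ∀ d ∈ admissibleVacuumData X, ∃ (e : AFEnd X) (G : EuclideanSpace ℝ (Fin 1) → InitialDataSet (𝓡 3) X), InitialDataSet.IsTameDataFamily e 1 G ∧ G 0 = d ∧ (∀ c, G c ∈ admissibleVacuumData X) ∧ ∀ c ≠ 0, ∃ M : ℝ, e.IsStronglyAsymptoticallyFlatWith (G c) M 1 2 6 5 :=
  fun h X _ _ _ _ _ _ d hd ↦ farCleaning_of_broom (h X d hd)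

/-- **It suffices to clean given the handed-over end.** To witness the conclusion of
`stub_farCleaning` at an admissible datum `d` it suffices to do so given ANY sole end `e` of `X` on
which `d` is Dafermos–Rodnianski flat with some mass `M` (the answer may live on another end
structure `e'`, e.g. a collar `e.restrict _`): admissibility hands over such an end
(`exists_isSoleEnd_of_mem_admissibleVacuumData`). [cite: Christodoulou1999, p. A24] -/
theorem farCleaning_of_onEnd : ∀ {X : Type} [TopologicalSpace X] [ChartedSpace E3 X] [IsManifold (𝓡 3) ∞ X] {d : InitialDataSet (𝓡 3) X}, d ∈ admissibleVacuumData X → (∀ (e : AFEnd X) (M : ℝ), e.IsSoleEnd → e.IsStronglyAsymptoticallyFlatDR d M → ∃ (e' : AFEnd X) (G : EuclideanSpace ℝ (Fin 1) → InitialDataSet (𝓡 3) X), InitialDataSet.IsTameDataFamily e' 1 G ∧ G 0 = d ∧ (∀ c, G c ∈ admissibleVacuumData X) ∧ ∀ c ≠ 0, ∃ M' : ℝ, e'.IsStronglyAsymptoticallyFlatWith (G c) M' 1 2 6 5) → ∃ (e : AFEnd X) (G : EuclideanSpace ℝ (Fin 1) → InitialDataSet (𝓡 3) X), InitialDataSet.IsTameDataFamily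 e 1 G ∧ G 0 = d ∧ (∀ c, G c ∈ admissibleVacuumData X) ∧ ∀ c ≠ 0, ∃ M : ℝ, e.IsStronglyAsymptoticallyFlatWith (G c) M 1 2 6 5 := by
  intro X _ _ _ d hd h
  obtain ⟨e, he, M, hDR⟩ := exists_isSoleEnd_of_mem_admissibleVacuumData hd
  exact h e M he hDR

end Summit.FinalStateConjecture.FinalStateConjecture.Theorems.StarvedNecks.FarCleaning

end
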